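import Literature.MathematicalPhysics.QuantumFieldTheory.Balaban1983to89.B7Eq106ConcreteRec

/-!
# `Balaban1983to89.B7Eq108ConcreteRec` — [Balaban1985Averaging] Sect. D (101)–(108) pp. 32–33 (and Sect. B (62) p. 28) FOR THE RECORD's AVERAGING STRUCTURE ([Balaban1987RG1] (0.3)–(0.4)):
# PART 2 of the `B7Eq106Concrete` twin — the formulas (101)–(108) expressing the gauge-fixed quantities `(R_{0,x_k}U₁)(Γ^{(k)})`, `R(U₀(Γ^{(k)}))u`, `u_j` through `U̿₁ʲ, v_j` for the record twins;
# exact identities, proofs re-run from the engine's `B7Eq106Concrete` §5–§6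

statement-level skeleton of published theorems with citation tags; proofs where landed; nothing here is a claim about the Yang–Mills mass gap

CITATION HEADER (lean-in-tree rule).  Cell `pub-ymgap`, seat `pub-ymgap-dag-n05-e` g35 (N05-REC LEAD PEN); item R1 ([3] layer) of the road — the Sect. D FORMULAS (101)–(108) that [Balaban1987RG1] Sect. A
(1.18)–(1.31) manipulates (the cell's R2∕R4, n05-d).  `--kind proof --supports stmt-QuantumFields-20541` (K0⁷; count-neutral; no definition).  Sources READ: [3] pp. 28–33
(`paper:balaban1985-cmp98-averaging`) through the engine module `B7Eq106Concrete` §5–§6, re-run token for token over the record objects (TOKEN RULE as in `B7Eq106ConcreteRec`; (77)∕(84)∕(88) from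
`B7Eq84ConcreteRec`, (99) from `B7Eq99ConcreteRec`, (92)∕(97) from `B7Eq92ConcreteRec`, level symbols from `B7Eq106ConcreteRec`).  The flat-background reductions are NOT twinned here (LOCATED-N2 layer).
WHAT IS PROVED (sorry-free): §5 ★`eq101Z`, `eq102Z`, `eq102Z_lv`, ★`eq103Z`, `telTwZ_eq_vcovZ_mul_telProdZ`, ★`eq104Z`, `eq104Z_dprod`, `eq104Z_glevZ`, `eq105Z`; §6 ★`eq106Z`, `eq106Z_glevZ`, ★`eq107Z`, `eq107Z_glevZ`,
★`eq108Z`, `eq108Z_R0fun`, `eq108Z_glevZ`, `eq62Z_transport`, `eq62Z_frame` ((62) of Sect. B as the case `k = 1`).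
HONEST SCOPE.  Exact algebraic identities for OUR typed record objects; no estimate; `HThm4Rec` UNDISCHARGED; N05 ∕ N07 NOT discharged; counts unmoved (typed 28∕28 · discharged 7∕28);
one finite 𝕋⁴ programme at fixed ε — nothing continuum ∕ ℝ⁴ ∕ OS ∕ mass gap ∕ Clay.  No `def`, no `instance`, no `notation`, no `sorry`.
-/

set_option autoImplicit false

noncomputable section

open scoped BigOperators
open NormedSpace Finset

namespace Literature.MathematicalPhysics.QuantumFieldTheory.Balaban1983to89.B7Eq108ConcreteRec

open B7Prop1Explicit hiding Site
open B7Prop1Explicit renaming Site → SiteZ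
open B7Prop2Explicit (rescale rescale_apply)
open MatrixLog B7AvgGaugeCovariance
open B7Eq92Concrete (Rc Rc_apply Rc_mul Rc_inv_apply Rc_one_apply mgauge mgauge_apply mgauge_mul tHol tHol_nil tHol_append_true tHol_append_false tHol_mgauge mlog_Rc expUnit_conj
  frame_eq_mgauge)
open B7Eq99Concrete (R0fun R0fun_apply R0fun_self R0fun_one_left R0fun_add inv_mul_const_mul tHol_mgauge_mul_R0fun)
open B7Eq84Concrete (R0fun_mul eq72_iff_eq76 Rc_injective)
open B7Eq106Concrete (dprod dprod_zero dprod_succ dprod_one' dprod_congr map_dprod mgauge_mgauge uLev_add uLev_mul)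
open BlockAveragingZd (offZ bavgZ avgIterZ avgIterZ_zero avgIterZ_succ)
open BlockAveragingZdCovariance (bavgZ_gaugeAct_units avgIterZ_gaugeAct_units)
open B7SectCDGaugeAveragesRec (flZ bremZ bctrZ offZ_bctrZ flZ_decomp flZ_block bremZ_block FcovZ wframeZ tildZ dbavgCovZ tildIterZ dbavgCovIterZ vcovZ SexpZ savgZ R0avgZ
  wrecZ wrecZ_zero tildIterZ_apply uavgZ uavgZ_zero uavgZ_succ AxialGaugeZ glevZ telHolZ telTwZ telHolZ_zero telTwZ_zero lvHolZ lvTwZ lvDbTZ lvFrZ telUpZ telProdZ telProdZ_zero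
  dbavgCovIterZ_zero dbavgCovIterZ_succ vcovZ_zero vcovZ_succ)
open B7Eq92ConcreteRec (tildZ_apply dbavgCovZ_apply tildIter_zero' tildIterZ_succ tildIterZ_mul dbavgCovIterZ_succ_apply vcovZ_succ_apply)
open B7Eq99ConcreteRec (SexpZ_apply savgZ_apply val_savgZ savgZ_const_mul savgZ_of_center_eq_one savgZ_tHol val_R0avgZ R0avgZ_of_60 wrecZ_succ wrecZ_one wrecZ_eq_vcovZ
  step100Z eq92Z tildIterZ_eq_mgauge_wrecZ eq88_of_87Z avgIterZ_eq_of_87)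
open B7Eq84ConcreteRec (SexpZ_congr savgZ_congr uavgZ_one eq76_of_axialGaugeZ eq84Z eq84Z_top eq81_iff_eq87Z eq88Z avgIterZ_eq_of_gauge bremZ_centre flZ_smul glevZ_of_lt glevZ_top
  glevZ_centre uLev_glevZ glevZ_block axialGaugeZ_glevZ eq81_glevZ gaugeFixingZ_exists gaugeFixingZ_unique eq88_glevZ avgIterZ_glevZ telHolZ_succ telTwZ_succ telRotZ_succ eq77Z
  gauge_formulaZ glevZ_formula)
open B7Eq106ConcreteRec (iterate_flZ_shift avgIterZ_add dbavgCovIterZ_add tildIterZ_add vcovZ_add uavgZ_add axialGaugeZ_shift telHolZ_succ' telTwZ_succ' telUpZ_zero telUp_zero_left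
  telProdZ_succ telTwZ_eq_telProdZ lvHolZ_shift lvTwZ_shift lvDbTZ_shift lvFrZ_shift telUpZ_succ telUpZ_succ_right telHolZ_split telProdZ_eq_dprod Rc_inv_telProdZ_eq_dprod)

variable {d : ℕ}

/-! ## §5 Formulas (101)–(105) -/

section Eq104

variable {𝔸 : Type*} [NormedRing 𝔸] [NormedAlgebra ℂ 𝔸] [CompleteSpace 𝔸]

/-- **(101)** p. 33: "R(U₀(Γ^{(k)}_{y,x}))u(x) = (\overline{R_{0,y}U₁}^{(k)})⁻¹ ∏_{j=k−1}^{0} R(Ū₀^{j+1}(Γ^{(k−j−1)}_{y,x_{j+1}}))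
·(R̄^j_{0,x_{j+1}}Ũ^j_1)(Γ_{x_{j+1},x_j}), (101) where x ∈ B^k(y), y ∈ Ω^{(k)}, x_k = y, x_0 = x" — "the gauge transformation u
calculated before in terms of U₁ and given by the equalities (77) for j = k−1, (87)" (p. 32), under the gauge conditions
(67) at the levels `< k` and the averaging condition (81) (⇔ (87)) at level `k`; `y = x_k = (flZ L)^[k] x`,
`\overline{R_{0,y}U₁}^{(k)} = wrecZ … k y` (85). [cite: Balaban1985Averaging, (101) p.33, (77) p.30, (87) p.31] -/
theorem eq101Z (L : ℕ) (hL : 1 ≤ L) (U₀ U₁ : SiteZ d → Fin d → 𝔸ˣ) {u : SiteZ d → 𝔸ˣ} {k : ℕ}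
    (hax : AxialGaugeZ L U₀ U₁ u k) (h81 : ∀ z : SiteZ d, uavgZ L U₀ u k z = 1) (x : SiteZ d) :
    Rc (telHolZ L hL U₀ k x) (u x)
      = (wrecZ L U₀ U₁ k ((flZ L)^[k] x))⁻¹
        * dprod (fun j => Rc (telUpZ L hL U₀ (j + 1) (k - j - 1) x) (lvTwZ L hL U₀ U₁ j x)) k := by
  rw [eq77Z L hL U₀ U₁ u hax k le_rfl x, (eq81_iff_eq87Z L U₀ U₁ u hax _).1 (h81 _), telTwZ_eq_telProdZ,
    telProdZ_eq_dprod]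

/-- **(102)** p. 33: "We use the equalities (97) and we get for j > 0 (R̄^j_{0,x_{j+1}}Ũ^j_1)(Γ_{x_{j+1},x_j}) =
v_j(x_{j+1})(R̄^j_{0,x_{j+1}}U̿^j_1)(Γ_{x_{j+1},x_j})·(R̄^j_{0,x_{j+1}}v_j)⁻¹(x_j). (102)" — the fundamental equality (97)
`Ũ₁^j = (U̿₁^j)^{v_j}` (`B7Eq92Concrete.B7Eq92ConcreteRec.tildIterZ_eq_mgauge`) transported along a tree contour (covariance of (58),
`tHol_mgauge`); here for every centre `y` and endpoint `x` (`Γ_{y,x} = treeWord (x − y)`), every `j ≥ 0` (at `j = 0`, `v_0 = 1`).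
[cite: Balaban1985Averaging, (102) p.33, (97) p.32, (58) p.27] -/
theorem eq102Z (L : ℕ) (U₀ U₁ : SiteZ d → Fin d → 𝔸ˣ) (j : ℕ) (y x : SiteZ d) :
    tHol (avgIterZ L U₀ j) (tildIterZ L U₀ U₁ j) y (treeWord (x - y))
      = vcovZ L U₀ U₁ j y * tHol (avgIterZ L U₀ j) (dbavgCovIterZ L U₀ U₁ j) y (treeWord (x - y))
          * (R0fun (avgIterZ L U₀ j) y (vcovZ L U₀ U₁ j) x)⁻¹ := by
  rw [B7Eq92ConcreteRec.tildIterZ_eq_mgauge L U₀ U₁ j, tHol_mgauge, disp_treeWord, add_sub_cancel, R0fun_apply]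

/-- **(102) for the contour `Γ_{x_{m+1},x_m}` of the telescoping** (`x_m ∈ B(x_{m+1})`, `x_m = L·x_{m+1} + r` by Euclidean division):
`(R̄^m_{0,x_{m+1}}Ũ₁^m)(Γ_{x_{m+1},x_m}) = v_m(x_{m+1})·(R̄^m_{0,x_{m+1}}U̿₁^m)(Γ_{x_{m+1},x_m})·[R(Ū₀^m(Γ_{x_{m+1},x_m}))v_m(x_m)]⁻¹`.
[cite: Balaban1985Averaging, (102) p.33] -/
theorem eq102Z_lv (L : ℕ) (hL : 1 ≤ L) (U₀ U₁ : SiteZ d → Fin d → 𝔸ˣ) (m : ℕ) (x : SiteZ d) :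
    lvTwZ L hL U₀ U₁ m x
      = vcovZ L U₀ U₁ m ((L : ℤ) • flZ L ((flZ L)^[m] x)) * lvDbTZ L hL U₀ U₁ m x
          * (Rc (lvHolZ L hL U₀ m x) (vcovZ L U₀ U₁ m ((flZ L)^[m] x)))⁻¹ := by
  rw [lvTwZ, B7Eq92ConcreteRec.tildIterZ_eq_mgauge L U₀ U₁ m, tHol_mgauge, disp_treeWord, flZ_decomp hL]
  rfl

/-- **(103)** p. 33: "If we take two neighboring factors for j, j−1 in (101), then the last factor on the right-hand side above
for j and the first factor for j−1 give the product (R(Ū₀^{j+1}(Γ^{(k−j−1)}_{y,x_{j+1}}))R(Ū₀^j(Γ_{x_{j+1},x_j}))v_j⁻¹(x_j))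
(R(Ū₀^j(Γ^{(k−j)}_{y,x_j}))v_{j−1}(x_j)) = R(Ū₀^j(Γ^{(k−j)}_{y,x_j}))(v_j⁻¹(x_j)v_{j−1}(x_j)) = R(Ū₀^j(Γ^{(k−j)}_{y,x_j}))(\overline{R̄^{j−1}_{0,x_j}U̿^{j−1}_1})⁻¹,
(103) where we have used the second Eq. (97)." Here `j = i + 1 ≥ 1`, `k − j − 1 = n` (any `n ≥ 0`), `x_j = (flZ L)^[i+1] x`, and
`v_{j−1}(x_j)` is `v_i` at the point `x_{i+1} ∈ Ω^{(i+1)} ⊂ Ω^{(i)}`, i.e. at `L·x_{i+1}` in level-`i` coordinates.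
[cite: Balaban1985Averaging, (103) p.33, (97) p.32, (57) p.27] -/
theorem eq103Z (L : ℕ) (hL : 1 ≤ L) (U₀ U₁ : SiteZ d → Fin d → 𝔸ˣ) (i n : ℕ) (x : SiteZ d) :
    Rc (telUpZ L hL U₀ (i + 2) n x)
          (Rc (lvHolZ L hL U₀ (i + 1) x) (vcovZ L U₀ U₁ (i + 1) ((flZ L)^[i + 1] x))⁻¹)
        * Rc (telUpZ L hL U₀ (i + 1) (n + 1) x) (vcovZ L U₀ U₁ i ((L : ℤ) • (flZ L)^[i + 1] x))
      = Rc (telUpZ L hL U₀ (i + 1) (n + 1) x)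
          ((vcovZ L U₀ U₁ (i + 1) ((flZ L)^[i + 1] x))⁻¹ * vcovZ L U₀ U₁ i ((L : ℤ) • (flZ L)^[i + 1] x))
    ∧ Rc (telUpZ L hL U₀ (i + 1) (n + 1) x)
          ((vcovZ L U₀ U₁ (i + 1) ((flZ L)^[i + 1] x))⁻¹ * vcovZ L U₀ U₁ i ((L : ℤ) • (flZ L)^[i + 1] x))
      = Rc (telUpZ L hL U₀ (i + 1) (n + 1) x) (lvFrZ L U₀ U₁ i x)⁻¹ := by
  have e : telUpZ L hL U₀ (i + 2) n x * lvHolZ L hL U₀ (i + 1) x = telUpZ L hL U₀ (i + 1) (n + 1) x :=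
    (telUpZ_succ_right L hL U₀ (i + 1) n x).symm
  constructor
  · rw [← MonoidHom.comp_apply (Rc _) (Rc _), ← Rc_mul, e, ← map_mul]
  · congr 1
    rw [lvFrZ, Function.iterate_succ_apply', B7SectCDGaugeAveragesRec.vcovZ_succ, mul_inv_rev, inv_mul_cancel_right]

/-- **THE TELESCOPING BEHIND (104), AS AN IDENTITY OF THE FORMAL OBJECTS** (any `L ≥ 1`, any unit-valued `U₀`, `U₁`, every
level `m` and site `x`; NO gauge conditions, no smallness): the symbol `(R_{0,x_m}U₁)(Γ^{(m)}_{x_m,x})` of (77)/(101) equals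
`v_m(x_m) · ∏_{j=m−1}^{0} R(Ū₀^{j+1}(Γ^{(m−j−1)}_{x_m,x_{j+1}}))[(\overline{R̄^j_{0,x_{j+1}}U̿₁^j})⁻¹(R̄^j_{0,x_{j+1}}U̿₁^j)(Γ_{x_{j+1},x_j})]` —
print's manipulation (102)–(103): substitute (102) in each factor; the frames `v_j` of neighbouring factors telescope
to `(\overline{R̄^{j−1}_{0,x_j}U̿^{j−1}_1})⁻¹` by the second Eq. (97), leaving `v_m(x_m)` on the far left (print removes it
with (87)/(99): "The first factor in (102) for j + 1 = k and the first factor on the right-hand side of (101) give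
v_k⁻¹(y)v_{k−1}(y)"). Proof by induction on `m`, each step being (102) at level `m` and `v_{m+1}(x_{m+1}) =
v_m(x_{m+1})(\overline{R̄^m_{0,x_{m+1}}U̿₁^m})`. [cite: Balaban1985Averaging, (101)–(104) p.33, (97) p.32] -/
theorem telTwZ_eq_vcovZ_mul_telProdZ (L : ℕ) (hL : 1 ≤ L) (U₀ U₁ : SiteZ d → Fin d → 𝔸ˣ) (x : SiteZ d) :
    ∀ m : ℕ, telTwZ L hL U₀ U₁ m x
      = vcovZ L U₀ U₁ m ((flZ L)^[m] x)
        * telProdZ L hL U₀ x (fun j => (lvFrZ L U₀ U₁ j x)⁻¹ * lvDbTZ L hL U₀ U₁ j x) m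
  | 0 => by rw [telTwZ_zero, telProdZ_zero, mul_one]; rfl
  | m + 1 => by
    rw [telTwZ_succ', telProdZ_succ, eq102Z_lv, telTwZ_eq_vcovZ_mul_telProdZ L hL U₀ U₁ x m, map_mul,
      Function.iterate_succ_apply', B7SectCDGaugeAveragesRec.vcovZ_succ]
    simp only [lvFrZ, mul_assoc, inv_mul_cancel_left, mul_inv_cancel_left]

/-- **(104)** p. 33: "Thus we obtain the equality R(U₀(Γ^{(k)}_{y,x}))u(x) = ∏_{j=k−1}^{0} R(Ū₀^{j+1}(Γ^{(k−j−1)}_{y,x_{j+1}}))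
·[(\overline{R̄^j_{0,x_{j+1}}U̿^j_1})⁻¹(R̄^j_{0,x_{j+1}}U̿^j_1)(Γ_{x_{j+1},x_j})]. (104)" — under the gauge conditions (67) at the levels
`< k` and the averaging condition (81) at level `k` (`y = x_k`): the gauge transformation expressed by the averagings
`U̿₁^j` alone. From (101) (`B7Eq84Concrete.eq77Z` + (87)), (99) `\overline{R_{0,y}U₁}^{(k)} = v_k(y)` and the telescoping
`telTwZ_eq_vcovZ_mul_telProdZ`. Recursive form; the displayed product is `eq104Z_dprod`.
[cite: Balaban1985Averaging, (104) p.33, (99) p.32, (87) p.31] -/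
theorem eq104Z (L : ℕ) (hL : 1 ≤ L) (U₀ U₁ : SiteZ d → Fin d → 𝔸ˣ) {u : SiteZ d → 𝔸ˣ} {k : ℕ}
    (hax : AxialGaugeZ L U₀ U₁ u k) (h81 : ∀ z : SiteZ d, uavgZ L U₀ u k z = 1) (x : SiteZ d) :
    Rc (telHolZ L hL U₀ k x) (u x)
      = telProdZ L hL U₀ x (fun j => (lvFrZ L U₀ U₁ j x)⁻¹ * lvDbTZ L hL U₀ U₁ j x) k := by
  rw [eq77Z L hL U₀ U₁ u hax k le_rfl x, (eq81_iff_eq87Z L U₀ U₁ u hax _).1 (h81 _), wrecZ_eq_vcovZ,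
    telTwZ_eq_vcovZ_mul_telProdZ, inv_mul_cancel_left]

/-- **(104) as displayed**, with the ordered product `∏_{j=k−1}^{0}` and the relative rotations
`R(Ū₀^{j+1}(Γ^{(k−j−1)}_{y,x_{j+1}}))`. [cite: Balaban1985Averaging, (104) p.33] -/
theorem eq104Z_dprod (L : ℕ) (hL : 1 ≤ L) (U₀ U₁ : SiteZ d → Fin d → 𝔸ˣ) {u : SiteZ d → 𝔸ˣ} {k : ℕ}
    (hax : AxialGaugeZ L U₀ U₁ u k) (h81 : ∀ z : SiteZ d, uavgZ L U₀ u k z = 1) (x : SiteZ d) :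
    Rc (telHolZ L hL U₀ k x) (u x)
      = dprod (fun j => Rc (telUpZ L hL U₀ (j + 1) (k - j - 1) x)
          ((lvFrZ L U₀ U₁ j x)⁻¹ * lvDbTZ L hL U₀ U₁ j x)) k := by
  rw [eq104Z L hL U₀ U₁ hax h81 x, telProdZ_eq_dprod]

/-- (104) for THE gauge fixing of `B7Eq84Concrete` §4 (`glevZ … k 0`, which satisfies (67) and (81)), with no hypothesis left.
[cite: Balaban1985Averaging, (104) p.33, p.31 (first sentence after (87))] -/
theorem eq104Z_glevZ (L : ℕ) (hL : 1 ≤ L) (U₀ U₁ : SiteZ d → Fin d → 𝔸ˣ) (k : ℕ) (x : SiteZ d) :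
    Rc (telHolZ L hL U₀ k x) (glevZ L hL U₀ U₁ k 0 x)
      = telProdZ L hL U₀ x (fun j => (lvFrZ L U₀ U₁ j x)⁻¹ * lvDbTZ L hL U₀ U₁ j x) k :=
  eq104Z L hL U₀ U₁ (axialGaugeZ_glevZ L hL U₀ U₁ k) (eq81_glevZ L hL U₀ U₁ k) x

/-- **(105)** p. 33: "Let us recall that we have (\overline{R̄^j_{0,x_{j+1}}U̿^j_1}) = exp[iΣ_{x∈B(x_{j+1})}L^{−d}(1/i) log(R̄^j_{0,x_{j+1}}U̿^j_1)(Γ_{x_{j+1},x})].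
(105)" — the definition (82) of the block frame, for `U̿₁^j` at `Ū₀^j` (`i·(1/i) = 1`; the block points are `x = L·x_{j+1} + r`,
`r ∈ [0, L)^d`, `log` = the series (21) `MatrixLog.mlog`). [cite: Balaban1985Averaging, (105) p.33, (82) p.30] -/
theorem eq105Z (L : ℕ) (U₀ U₁ : SiteZ d → Fin d → 𝔸ˣ) (j : ℕ) (x : SiteZ d) :
    ((lvFrZ L U₀ U₁ j x : 𝔸ˣ) : 𝔸)
      = exp (∑ r : Fin d → Fin L, (((L : ℝ) ^ d)⁻¹)
          • mlog ((tHol (avgIterZ L U₀ j) (dbavgCovIterZ L U₀ U₁ j) ((L : ℤ) • flZ L ((flZ L)^[j] x))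
              (treeWord (offZ L r)) : 𝔸ˣ) : 𝔸)) := rfl

end Eq104

/-! ## §6 Formulas (106)–(108), and (62) of Sect. B as the case `k = 1` -/

section Eq106

variable {𝔸 : Type*} [NormedRing 𝔸] [NormedAlgebra ℂ 𝔸] [CompleteSpace 𝔸]

/-- **(106)** p. 33: "The Eq. (104) can be written also in the following way: u(x) = ∏_{j=k−1}^{0} (R(U₀(Γ^{(j+1)}_{x_{j+1},x})))⁻¹
[(\overline{R̄^j_{0,x_{j+1}}U̿^j_1})⁻¹(R̄^j_{0,x_{j+1}}U̿^j_1)(Γ_{x_{j+1},x_j})], (106)" — under (67) at the levels `< k` and (81) at level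
`k`: conjugate (104) back by `R(U₀(Γ^{(k)}_{y,x}))⁻¹` and use `U₀(Γ^{(k)}_{y,x}) = Ū₀^{j+1}(Γ^{(k−j−1)}_{y,x_{j+1}})U₀(Γ^{(j+1)}_{x_{j+1},x})`
with (57) (`Rc_inv_telProdZ_eq_dprod`). [cite: Balaban1985Averaging, (106) p.33, (57) p.27] -/
theorem eq106Z (L : ℕ) (hL : 1 ≤ L) (U₀ U₁ : SiteZ d → Fin d → 𝔸ˣ) {u : SiteZ d → 𝔸ˣ} {k : ℕ}
    (hax : AxialGaugeZ L U₀ U₁ u k) (h81 : ∀ z : SiteZ d, uavgZ L U₀ u k z = 1) (x : SiteZ d) :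
    u x = dprod (fun j => Rc (telHolZ L hL U₀ (j + 1) x)⁻¹
          ((lvFrZ L U₀ U₁ j x)⁻¹ * lvDbTZ L hL U₀ U₁ j x)) k := by
  rw [← (Rc_inv_apply (telHolZ L hL U₀ k x) (u x)).1, eq104Z L hL U₀ U₁ hax h81 x, Rc_inv_telProdZ_eq_dprod]

/-- (106) for THE gauge fixing `glevZ … k 0` of `B7Eq84Concrete` §4, with no hypothesis left: an explicit formula for the
gauge fixing in terms of the background transporters and the double-bar averages `U̿₁^j`, `j < k`, only.
[cite: Balaban1985Averaging, (106) p.33, p.31 (first sentence after (87))] -/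
theorem eq106Z_glevZ (L : ℕ) (hL : 1 ≤ L) (U₀ U₁ : SiteZ d → Fin d → 𝔸ˣ) (k : ℕ) :
    glevZ L hL U₀ U₁ k 0 = fun x => dprod (fun j => Rc (telHolZ L hL U₀ (j + 1) x)⁻¹
          ((lvFrZ L U₀ U₁ j x)⁻¹ * lvDbTZ L hL U₀ U₁ j x)) k :=
  funext fun x => eq106Z L hL U₀ U₁ (axialGaugeZ_glevZ L hL U₀ U₁ k) (eq81_glevZ L hL U₀ U₁ k) x

/-- **(107)** p. 33: "and this gives the formulas (\overline{R₀u})^j(x_j) = ∏_{l=k−1}^{j} (R(Ū₀^j(Γ^{(l+1−j)}_{x_{l+1},x_j})))⁻¹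
·[(\overline{R̄^l_{0,x_{l+1}}U̿^l_1})⁻¹(R̄^l_{0,x_{l+1}}U̿^l_1)(Γ_{x_{l+1},x_l})], (107)" — under (67) at the levels `< k` and (81) at level `k`,
for every `j ≤ k` (`l = j + i`, `i = k−1−j, …, 0`; `x_j = (flZ L)^[j] x`). PROOF: (106) for the LEVEL-`j` PROBLEM — background
`Ū₀^j`, field `U̿₁^j`, gauge transformation `\overline{R₀u}^j`, `k − j` levels — which satisfies (67) (`axialGaugeZ_shift`) and
(81) (`\overline{R₀′(\overline{R₀u}^j)}^{k−j} = \overline{R₀u}^k = 1`, (80) composed), its level-`i` symbols being the level-`(j+i)`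
symbols of the original ((43)/(91) composed). At `j = 0` this is (106). [cite: Balaban1985Averaging, (107) p.33, (106) p.33, (91) p.31] -/
theorem eq107Z (L : ℕ) (hL : 1 ≤ L) (U₀ U₁ : SiteZ d → Fin d → 𝔸ˣ) {u : SiteZ d → 𝔸ˣ} {k : ℕ}
    (hax : AxialGaugeZ L U₀ U₁ u k) (h81 : ∀ z : SiteZ d, uavgZ L U₀ u k z = 1) {j : ℕ} (hj : j ≤ k) (x : SiteZ d) :
    uavgZ L U₀ u j ((flZ L)^[j] x)
      = dprod (fun i => Rc (telUpZ L hL U₀ j (i + 1) x)⁻¹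
          ((lvFrZ L U₀ U₁ (j + i) x)⁻¹ * lvDbTZ L hL U₀ U₁ (j + i) x)) (k - j) := by
  have h81' : ∀ z : SiteZ d, uavgZ L (avgIterZ L U₀ j) (uavgZ L U₀ u j) (k - j) z = 1 := by
    intro z
    rw [uavgZ_add, Nat.add_sub_cancel' hj]
    exact h81 z
  rw [eq106Z L hL (avgIterZ L U₀ j) (dbavgCovIterZ L U₀ U₁ j) (axialGaugeZ_shift L U₀ U₁ u hax hj) h81'
    ((flZ L)^[j] x)]
  refine dprod_congr _ _ (k - j) fun i _ => ?_
  rw [lvFrZ_shift, lvDbTZ_shift]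
  rfl

/-- (107) for THE gauge fixing `glevZ … k 0` of `B7Eq84Concrete` §4, with no hypothesis left.
[cite: Balaban1985Averaging, (107) p.33] -/
theorem eq107Z_glevZ (L : ℕ) (hL : 1 ≤ L) (U₀ U₁ : SiteZ d → Fin d → 𝔸ˣ) {k j : ℕ} (hj : j ≤ k) (x : SiteZ d) :
    uavgZ L U₀ (glevZ L hL U₀ U₁ k 0) j ((flZ L)^[j] x)
      = dprod (fun i => Rc (telUpZ L hL U₀ j (i + 1) x)⁻¹
          ((lvFrZ L U₀ U₁ (j + i) x)⁻¹ * lvDbTZ L hL U₀ U₁ (j + i) x)) (k - j) :=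
  eq107Z L hL U₀ U₁ (axialGaugeZ_glevZ L hL U₀ U₁ k) (eq81_glevZ L hL U₀ U₁ k) hj x

/-- **(108)** p. 33: "(\overline{R₀u^j})⁻¹(x_{j+1})R(Ū₀^j(Γ_{x_{j+1},x_j}))(\overline{R₀u^j})(x_j) = (R̄^j_{0,x_{j+1}}U̿^j_1)(Γ_{x_{j+1},x_j}). (108)" — under
the gauge conditions (67) at the levels `< k`, for every `j < k`, `x_{j+1} = Lz`, `x_j = Lz + r ∈ B(x_{j+1})`: along the tree contours,
`U̿₁^j` is the RELATIVE PURE GAUGE of the averaged gauge transformation `\overline{R₀u}^j`. PROOF: the level-`0` axial gauge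
condition of the level-`j` problem (`axialGaugeZ_shift`), solved as in (72) ⇔ (76) — equivalently (84) `\overline{R₀u}^j = u_jv_j`,
(76) and (102). ((81) is not needed.) [cite: Balaban1985Averaging, (108) p.33, (76) p.29, (84) p.30, (102) p.33] -/
theorem eq108Z (L : ℕ) (U₀ U₁ : SiteZ d → Fin d → 𝔸ˣ) {u : SiteZ d → 𝔸ˣ} {k : ℕ} (hax : AxialGaugeZ L U₀ U₁ u k)
    {j : ℕ} (hj : j < k) (z : SiteZ d) (r : Fin d → Fin L) :
    (uavgZ L U₀ u j ((L : ℤ) • z))⁻¹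
        * Rc (hol (avgIterZ L U₀ j) ((L : ℤ) • z) (treeWord (offZ L r)))
            (uavgZ L U₀ u j ((L : ℤ) • z + offZ L r))
      = tHol (avgIterZ L U₀ j) (dbavgCovIterZ L U₀ U₁ j) ((L : ℤ) • z) (treeWord (offZ L r)) := by
  have h := axialGaugeZ_shift L U₀ U₁ u hax hj.le 0 (Nat.sub_pos_of_lt hj) z r
  rw [avgIterZ_zero, tildIter_zero', tHol_mgauge, disp_treeWord, mul_inv_eq_one] at h
  rw [← h, inv_mul_cancel_left]

/-- (108) with the rotated-function notation `(R̄^j_{0,x_{j+1}}\overline{R₀u}^j)(x_j)` (`B7Eq99Concrete.R0fun`).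
[cite: Balaban1985Averaging, (108) p.33] -/
theorem eq108Z_R0fun (L : ℕ) (U₀ U₁ : SiteZ d → Fin d → 𝔸ˣ) {u : SiteZ d → 𝔸ˣ} {k : ℕ} (hax : AxialGaugeZ L U₀ U₁ u k)
    {j : ℕ} (hj : j < k) (z : SiteZ d) (r : Fin d → Fin L) :
    (uavgZ L U₀ u j ((L : ℤ) • z))⁻¹
        * R0fun (avgIterZ L U₀ j) ((L : ℤ) • z) (uavgZ L U₀ u j) ((L : ℤ) • z + offZ L r)
      = tHol (avgIterZ L U₀ j) (dbavgCovIterZ L U₀ U₁ j) ((L : ℤ) • z) (treeWord (offZ L r)) := by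
  rw [R0fun_add, eq108Z L U₀ U₁ hax hj z r]

/-- (108) for THE gauge fixing `glevZ … k 0` of `B7Eq84Concrete` §4, with no hypothesis left. [cite: Balaban1985Averaging, (108) p.33] -/
theorem eq108Z_glevZ (L : ℕ) (hL : 1 ≤ L) (U₀ U₁ : SiteZ d → Fin d → 𝔸ˣ) {k j : ℕ} (hj : j < k) (z : SiteZ d)
    (r : Fin d → Fin L) :
    (uavgZ L U₀ (glevZ L hL U₀ U₁ k 0) j ((L : ℤ) • z))⁻¹
        * Rc (hol (avgIterZ L U₀ j) ((L : ℤ) • z) (treeWord (offZ L r)))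
            (uavgZ L U₀ (glevZ L hL U₀ U₁ k 0) j ((L : ℤ) • z + offZ L r))
      = tHol (avgIterZ L U₀ j) (dbavgCovIterZ L U₀ U₁ j) ((L : ℤ) • z) (treeWord (offZ L r)) :=
  eq108Z L U₀ U₁ (axialGaugeZ_glevZ L hL U₀ U₁ k) hj z r

/-! ### The case `k = 1`: Sect. B's (62) p. 28 -/

/-- **(62), first equation** p. 28: "The equality (60) and the condition (61) imply v⁻¹(y)(R_{0,y}v)(x) = (R_{0,y}V₁)(Γ_{y,x})" —
(108) at `j = 0` (`\overline{R₀u}^0 = u`, `U̿₁^0 = U₁`, `Ū₀^0 = U₀`); only the axial gauge conditions (58)/(60) (= (67) at level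
`0`) are used. [cite: Balaban1985Averaging, (62) p.28, (108) p.33] -/
theorem eq62Z_transport (L : ℕ) (U₀ U₁ : SiteZ d → Fin d → 𝔸ˣ) {u : SiteZ d → 𝔸ˣ} {k : ℕ} (hax : AxialGaugeZ L U₀ U₁ u k)
    (hk : 0 < k) (z : SiteZ d) (r : Fin d → Fin L) :
    (u ((L : ℤ) • z))⁻¹ * R0fun U₀ ((L : ℤ) • z) u ((L : ℤ) • z + offZ L r)
      = tHol U₀ U₁ ((L : ℤ) • z) (treeWord (offZ L r)) := by
  simpa using eq108Z_R0fun L U₀ U₁ hax hk z r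

/-- **(62), second equation** p. 28: "v(y) = exp[−iΣ_{x∈B(y)}L^{−d}(1/i) log(R_{0,y}V₁)(Γ_{y,x})]" `= (\overline{R_{0,y}V₁})⁻¹` — (87) at
`k = 1` (`\overline{R_{0,y}U₁}^{(1)} = \overline{R_{0,y}U₁}`, `B7Eq99Concrete.wrecZ_one`), under (60) and the averaging condition (61)
(= (81) at `k = 1`). [cite: Balaban1985Averaging, (62) p.28, (87) p.31, (82) p.30] -/
theorem eq62Z_frame (L : ℕ) (U₀ U₁ : SiteZ d → Fin d → 𝔸ˣ) {u : SiteZ d → 𝔸ˣ} (hax : AxialGaugeZ L U₀ U₁ u 1)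
    (h61 : ∀ z : SiteZ d, uavgZ L U₀ u 1 z = 1) (z : SiteZ d) :
    u ((L : ℤ) • z) = (wframeZ L U₀ U₁ ((L : ℤ) • z))⁻¹ := by
  have h := (eq81_iff_eq87Z L U₀ U₁ u hax z).1 (h61 z)
  rw [wrecZ_one, uLev_apply, pow_one] at h
  exact h

end Eq106

end Literature.MathematicalPhysics.QuantumFieldTheory.Balaban1983to89.B7Eq108ConcreteRec
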